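import Literature.MathematicalPhysics.QuantumLattice.HubbardMatsubaraCutoffBlocks
import Literature.MathematicalPhysics.QuantumLattice.SymmetricRegimeFunctionals
import HarnessLib

/-!
# The exact Matsubara cutoff embedding `M ≤ M″`, III: effective actions, kernels and self-energies, shell-free infrared slices

Topic `MathematicalPhysics/QuantumLattice`; continuation of `HubbardMatsubaraCutoffEmbedding.lean` (`emb`, `E`,
`π = cutoffRestrict`, `ι = cutoffExtend`) and `HubbardMatsubaraCutoffBlocks.lean` (`π V″_K = V_K`,
`C″^K_{>Λ} = Eᵀ C^K_{>Λ} E + S`, `S = hubbardCovShellCT`).  With the tree's covariance of the operator calculus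
under linear substitutions (`GrassmannLinearSubstitution.effAction_map`, `kernel_map`) and the semigroup property
(`GrassmannEffectiveAction.effAction_add`) the two Hubbard tori at cutoffs `M ≤ M″` compare EXACTLY, at every
coupling:

* §5 `cutoffRestrict_effAction_windowConj` — `π (effAction (Eᵀ C E) F) = effAction C (π F)`; `effAction_cutoffExtend` —
  `effAction C″ (ι V) = ι (effAction (E C″ Eᵀ) V)`; hence
  **`cutoffRestrict_hubbardEffectiveActionCT`**: `π 𝒢″^K_Λ = effAction C^K_{>Λ} (π (effAction S V″_K))` (the theory
  at cutoff `M″` with its shell fields set to zero IS the theory at cutoff `M` started from the shell-integrated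
  interaction `π (effAction S V″_K)` instead of `V_K`; unit hypothesis on the shell partition function), the
  factorisation of the partition functions, and **`cutoffExtend_hubbardEffectiveActionCT`**:
  `ι 𝒢^K_Λ = effAction C″^K_{>Λ} (ι V_K)` (unconditional: the theory at cutoff `M` is the theory at cutoff `M″`
  whose interaction has the shell monomials deleted);
* §6 kernels, vertex functions, self-energies, field strengths and the Fermi-curve mismatch of `π F` are those of
  `F` at the embedded (window) labels (`kernel_cutoffRestrict`, `selfEnergy_cutoffRestrict`, …; `ω₀ ↦ ω₀`), so that
  `Σ″(emb k) - Σ(k)` is the self-energy of ONE scale map at two initial interactions (`selfEnergy_hubbardEffectiveActionCT_emb_sub`);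
* §7 below the shell floor `π(2M+1)/β` the shell weights are `1`: the SLICE covariances of the tower at cutoff
  `M″` are pure window, `C″^K_{(Λ,Λ′]} = Eᵀ C^K_{(Λ,Λ′]} E` (`hubbardCovSliceCT_eq_windowConj`), every infrared
  step restricts (`cutoffRestrict_effAction_hubbardCovSliceCT`), and the shell covariance is `Λ`-independent there
  (`hubbardCovShellCT_eq_of_le`): the cutoff `M` enters a multiscale tower only through the first (ultraviolet) step.

Everything is proved; no named fact.  Sources: BGM 2006 §2.1 (2.1)–(2.6), §2.2 (2.12)–(2.13) (the `M`-cutoff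
Grassmann integral and its effective potentials) [`BenfattoGiulianiMastropietro2006`]; Salmhofer 1999 §2.5.1
(2.105)–(2.106) (semigroup property), §4.2.5 (4.70)–(4.72), App. B.2 (B.23)–(B.25) (linear substitutions)
[`Salmhofer1999`].  The `[cite: …]` tags LOCATE the construct each statement is about; the statements are routine
consequences of the cited formulas, not named results of those sources.
-/

noncomputable section

namespace Literature.MathematicalPhysics.QuantumLattice

open GrassmannAlgebra Finset Literature.Probability.LatticeModels

/-! ### §5 Effective actions -/

section EffAction

variable {L : ℕ} [NeZero L] {M M'' : ℕ} (h : M ≤ M'')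

/-- **`π` through a window covariance**: `π (μ_{EᵀCE} ⋆ F) = μ_C ⋆ (π F)`. [cite: Salmhofer1999, App. B.2 (B.23)-(B.25)] -/
theorem cutoffRestrict_gaussConv_windowConj (C : Matrix (HubbardFieldIdx L M) (HubbardFieldIdx L M) ℂ) (F : HubbardGrassmann L M'') :
    cutoffRestrict L h (gaussConv ℂ ((windowMatrix L h).transpose * C * windowMatrix L h) F) = gaussConv ℂ C (cutoffRestrict L h F) := by
  rw [cutoffRestrict, gaussConv_map, toMatrix'_funLeft_emb]

/-- `π` through a window covariance, Boltzmann factors: `π (μ_{EᵀCE} ⋆ e^{-F}) = μ_C ⋆ e^{-π F}`.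
[cite: Salmhofer1999, App. B.2 (B.23)-(B.25)] -/
theorem cutoffRestrict_effBoltzmann_windowConj (C : Matrix (HubbardFieldIdx L M) (HubbardFieldIdx L M) ℂ) (F : HubbardGrassmann L M'') :
    cutoffRestrict L h (effBoltzmann ℂ ((windowMatrix L h).transpose * C * windowMatrix L h) F) = effBoltzmann ℂ C (cutoffRestrict L h F) := by
  rw [cutoffRestrict, effBoltzmann_map, toMatrix'_funLeft_emb]

/-- Partition functions of a window covariance: `∫ dμ_{EᵀCE} e^{-F} = ∫ dμ_C e^{-π F}`. [cite: Salmhofer1999, App. B.2 (B.23)-(B.25)] -/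
theorem effPartitionFn_windowConj (C : Matrix (HubbardFieldIdx L M) (HubbardFieldIdx L M) ℂ) (F : HubbardGrassmann L M'') :
    effPartitionFn ℂ ((windowMatrix L h).transpose * C * windowMatrix L h) F = effPartitionFn ℂ C (cutoffRestrict L h F) := by
  rw [cutoffRestrict, effPartitionFn_map, toMatrix'_funLeft_emb]

/-- **`π` through a window covariance, effective actions**: `π (effAction (EᵀCE) F) = effAction C (π F)` — the
Gaussian integral over window fluctuation fields commutes with setting the external shell fields to zero.
[cite: Salmhofer1999, App. B.2 (B.23)-(B.25)] -/
theorem cutoffRestrict_effAction_windowConj (C : Matrix (HubbardFieldIdx L M) (HubbardFieldIdx L M) ℂ) (F : HubbardGrassmann L M'') :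
    cutoffRestrict L h (effAction ℂ ((windowMatrix L h).transpose * C * windowMatrix L h) F) = effAction ℂ C (cutoffRestrict L h F) := by
  rw [cutoffRestrict, effAction_map, toMatrix'_funLeft_emb]

/-- **`ι` through any covariance**: `effAction C″ (ι V) = ι (effAction (E C″ Eᵀ) V)` — a function of the window
fields only integrates against the compressed covariance. [cite: Salmhofer1999, App. B.2 (B.23)-(B.25)] -/
theorem effAction_cutoffExtend (C'' : Matrix (HubbardFieldIdx L M'') (HubbardFieldIdx L M'') ℂ) (V : HubbardGrassmann L M) :
    effAction ℂ C'' (cutoffExtend L h V) = cutoffExtend L h (effAction ℂ (windowMatrix L h * C'' * (windowMatrix L h).transpose) V) := by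
  rw [cutoffExtend, effAction_map, toMatrix'_toLin'_windowMatrix_transpose, Matrix.transpose_transpose]

/-- `ι` through any covariance, partition functions: `∫ dμ_{C″} e^{-ι V} = ∫ dμ_{E C″ Eᵀ} e^{-V}`.
[cite: Salmhofer1999, App. B.2 (B.23)-(B.25)] -/
theorem effPartitionFn_cutoffExtend (C'' : Matrix (HubbardFieldIdx L M'') (HubbardFieldIdx L M'') ℂ) (V : HubbardGrassmann L M) :
    effPartitionFn ℂ C'' (cutoffExtend L h V) = effPartitionFn ℂ (windowMatrix L h * C'' * (windowMatrix L h).transpose) V := by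
  rw [cutoffExtend, effPartitionFn_map, toMatrix'_toLin'_windowMatrix_transpose, Matrix.transpose_transpose]

variable (β U μ hs : ℝ) (K : TrigPolyC4v) (Λ : ℝ)

/-- **The theory at cutoff `M″`, restricted to the window, is the theory at cutoff `M` started from the
shell-integrated interaction**: `π 𝒢″^K_Λ = effAction C^K_{>Λ} (π (effAction S V″_K))`, provided the shell
partition function `∫ dμ_S e^{-V″_K}` is a unit (semigroup property along `C″^K_{>Λ} = EᵀC^K_{>Λ}E + S`, then `π`
through the window covariance). [cite: Salmhofer1999, §2.5.1 (2.106)] -/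
theorem cutoffRestrict_hubbardEffectiveActionCT
    (hZ : IsUnit (effPartitionFn ℂ (hubbardCovShellCT L h β μ hs K Λ) (hubbardInteractionCT L M'' β U K))) :
    cutoffRestrict L h (hubbardEffectiveActionCT L M'' β U μ hs K Λ) =
      effAction ℂ (hubbardCovAboveCT L M β μ hs K Λ)
        (cutoffRestrict L h (effAction ℂ (hubbardCovShellCT L h β μ hs K Λ) (hubbardInteractionCT L M'' β U K))) := by
  rw [hubbardEffectiveActionCT, hubbardCovAboveCT_eq_window_add_shell h β μ hs K Λ, effAction_add ℂ _ _ _ hZ,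
    cutoffRestrict_effAction_windowConj]

/-- The same at the level of Boltzmann factors, unconditionally:
`π (μ_{C″_{>Λ}} ⋆ e^{-V″}) = μ_{C_{>Λ}} ⋆ π (μ_S ⋆ e^{-V″})`. [cite: Salmhofer1999, §2.5.1 (2.105)] -/
theorem cutoffRestrict_effBoltzmann_hubbardCovAboveCT :
    cutoffRestrict L h (effBoltzmann ℂ (hubbardCovAboveCT L M'' β μ hs K Λ) (hubbardInteractionCT L M'' β U K)) =
      gaussConv ℂ (hubbardCovAboveCT L M β μ hs K Λ)
        (cutoffRestrict L h (effBoltzmann ℂ (hubbardCovShellCT L h β μ hs K Λ) (hubbardInteractionCT L M'' β U K))) := by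
  rw [hubbardCovAboveCT_eq_window_add_shell h β μ hs K Λ, effBoltzmann_add, cutoffRestrict_gaussConv_windowConj]

/-- **Factorisation of the partition functions**: `Z″^K_Λ = (∫ dμ_S e^{-V″_K}) · ∫ dμ_{C^K_{>Λ}} e^{-π (effAction S V″_K)}`
(shell partition function a unit). [cite: Salmhofer1999, §2.5.1 (2.105)] -/
theorem hubbardEffPartitionFnCT_eq_mul
    (hZ : IsUnit (effPartitionFn ℂ (hubbardCovShellCT L h β μ hs K Λ) (hubbardInteractionCT L M'' β U K))) :
    hubbardEffPartitionFnCT L M'' β U μ hs K Λ =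
      effPartitionFn ℂ (hubbardCovShellCT L h β μ hs K Λ) (hubbardInteractionCT L M'' β U K) *
        effPartitionFn ℂ (hubbardCovAboveCT L M β μ hs K Λ)
          (cutoffRestrict L h (effAction ℂ (hubbardCovShellCT L h β μ hs K Λ) (hubbardInteractionCT L M'' β U K))) := by
  have h1 : effBoltzmann ℂ (hubbardCovAboveCT L M'' β μ hs K Λ) (hubbardInteractionCT L M'' β U K) =
      effPartitionFn ℂ (hubbardCovShellCT L h β μ hs K Λ) (hubbardInteractionCT L M'' β U K) •
        gaussConv ℂ ((windowMatrix L h).transpose * hubbardCovAboveCT L M β μ hs K Λ * windowMatrix L h)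
          (grassmannExp (-effAction ℂ (hubbardCovShellCT L h β μ hs K Λ) (hubbardInteractionCT L M'' β U K))) := by
    rw [hubbardCovAboveCT_eq_window_add_shell h β μ hs K Λ, effBoltzmann_add, effBoltzmann_eq_smul_grassmannExp ℂ _ _ hZ, map_smul]
  rw [hubbardEffPartitionFnCT, effPartitionFn, h1, map_smul, smul_eq_mul, ← effPartitionFn_windowConj h]
  rfl

/-- **The theory at cutoff `M`, extended, is the theory at cutoff `M″` with the shell monomials of the interaction
deleted**: `ι 𝒢^K_Λ = effAction C″^K_{>Λ} (ι V_K)` (unconditionally; `E C″^K_{>Λ} Eᵀ = C^K_{>Λ}`).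
[cite: BenfattoGiulianiMastropietro2006, §2.2 (2.12)-(2.13)] -/
theorem cutoffExtend_hubbardEffectiveActionCT :
    cutoffExtend L h (hubbardEffectiveActionCT L M β U μ hs K Λ) =
      effAction ℂ (hubbardCovAboveCT L M'' β μ hs K Λ) (cutoffExtend L h (hubbardInteractionCT L M β U K)) := by
  rw [hubbardEffectiveActionCT, effAction_cutoffExtend, windowCompress_hubbardCovAboveCT]

/-- … and the partition functions agree: `Z^K_Λ = ∫ dμ_{C″^K_{>Λ}} e^{-ι V_K}`. [cite: BenfattoGiulianiMastropietro2006, §2.2 (2.12)-(2.13)] -/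
theorem hubbardEffPartitionFnCT_eq_cutoffExtend :
    hubbardEffPartitionFnCT L M β U μ hs K Λ =
      effPartitionFn ℂ (hubbardCovAboveCT L M'' β μ hs K Λ) (cutoffExtend L h (hubbardInteractionCT L M β U K)) := by
  rw [hubbardEffPartitionFnCT, effPartitionFn_cutoffExtend, windowCompress_hubbardCovAboveCT]

/-- `π` undoes the extension of the interaction: `π (ι V_K) = V_K` (so `ι V_K` and `V″_K` have the SAME restriction,
`cutoffRestrict_hubbardInteractionCT`). [cite: BenfattoGiulianiMastropietro2006, §2.1 (2.6a)] -/
theorem cutoffRestrict_cutoffExtend_hubbardInteractionCT :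
    cutoffRestrict L h (cutoffExtend L h (hubbardInteractionCT L M β U K)) = cutoffRestrict L h (hubbardInteractionCT L M'' β U K) := by
  rw [cutoffRestrict_cutoffExtend, cutoffRestrict_hubbardInteractionCT]

end EffAction

/-! ### §6 Kernels, vertex functions and self-energies at window labels -/

section Kernels

variable {L : ℕ} [NeZero L] {M M'' : ℕ} (h : M ≤ M'')

/-- **Kernels of the restriction are the kernels at the embedded labels**: `kernel (π F) m X = kernel F m (emb ∘ X)`.
[cite: Salmhofer1999, §4.2.5 (4.72)] -/
theorem kernel_cutoffRestrict (F : HubbardGrassmann L M'') (m : ℕ) (X : Fin m → HubbardFieldIdx L M) :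
    kernel ℂ (cutoffRestrict L h F) m X = kernel ℂ F m (HubbardFieldIdx.emb h ∘ X) := by
  rw [cutoffRestrict, kernel_map, toMatrix'_funLeft_emb, Finset.sum_eq_single (HubbardFieldIdx.emb h ∘ X)]
  · rw [Finset.prod_eq_one fun i _ => by rw [windowMatrix_apply, Function.comp_apply, if_pos rfl], one_mul]
  · intro X'' _ hne
    obtain ⟨i, hi⟩ := Function.ne_iff.1 hne
    rw [Function.comp_apply] at hi
    rw [Finset.prod_eq_zero (Finset.mem_univ i) (by rw [windowMatrix_apply, if_neg (Ne.symm hi)]), zero_mul]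
  · exact fun hX => absurd (Finset.mem_univ _) hX

/-- Vertex functions of the restriction. [cite: Salmhofer1999, §4.2.5 (4.72)] -/
theorem vertexFn_cutoffRestrict (β : ℝ) (F : HubbardGrassmann L M'') (m : ℕ) (X : Fin m → HubbardFieldIdx L M) :
    vertexFn L M β (cutoffRestrict L h F) m X = vertexFn L M'' β F m (HubbardFieldIdx.emb h ∘ X) := by
  rw [vertexFn, vertexFn, kernel_cutoffRestrict]

/-- **Self-energies of the restriction are the self-energies at the embedded labels**:
`Σ(π F)(k, σ) = Σ(F)(emb k, σ)`. [cite: Salmhofer1999, §4.2.5 (4.72)] -/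
theorem selfEnergy_cutoffRestrict (β : ℝ) (F : HubbardGrassmann L M'') (k : FreqMomentum L M) (σ : Fin 2) :
    selfEnergy L M β (cutoffRestrict L h F) k σ = selfEnergy L M'' β F (FreqMomentum.emb h k) σ := by
  rw [selfEnergy, selfEnergy, vertexFn_cutoffRestrict]
  congr 1
  funext i
  fin_cases i <;> rfl

/-- The lowest frequency label goes to the lowest frequency label: `emb ω₀ = ω₀`. [cite: Salmhofer1999, §4.2.4 (4.63)] -/
@[simp] theorem MatsubaraIdx.emb_omega0 [NeZero M] [NeZero M''] : MatsubaraIdx.emb h (omega0 M) = omega0 M'' := by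
  apply Fin.ext
  simp only [MatsubaraIdx.coe_emb, omega0]
  omega

/-- Self-energies at the lowest frequencies `±ω₀`. [cite: Salmhofer1999, §4.2.5 (4.72)] -/
theorem selfEnergy_cutoffRestrict_omega0 [NeZero M] [NeZero M''] (β : ℝ) (F : HubbardGrassmann L M'') (k : TorusSite 2 L) (σ : Fin 2) :
    selfEnergy L M β (cutoffRestrict L h F) (omega0 M, k) σ = selfEnergy L M'' β F (omega0 M'', k) σ ∧
      selfEnergy L M β (cutoffRestrict L h F) ((omega0 M).rev, k) σ = selfEnergy L M'' β F ((omega0 M'').rev, k) σ := by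
  refine ⟨?_, ?_⟩
  · rw [selfEnergy_cutoffRestrict, FreqMomentum.emb, MatsubaraIdx.emb_omega0]
  · rw [selfEnergy_cutoffRestrict, FreqMomentum.emb, MatsubaraIdx.emb_rev, MatsubaraIdx.emb_omega0]

/-- Field strengths of the restriction. [cite: Salmhofer1999, §4.2.5 (4.72)] -/
theorem fieldStrengthSpin_cutoffRestrict [NeZero M] [NeZero M''] (β : ℝ) (F : HubbardGrassmann L M'') (k : TorusSite 2 L) (σ : Fin 2) :
    fieldStrengthSpin L M β (cutoffRestrict L h F) k σ = fieldStrengthSpin L M'' β F k σ := by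
  rw [fieldStrengthSpin, fieldStrengthSpin, (selfEnergy_cutoffRestrict_omega0 h β F k σ).1,
    (selfEnergy_cutoffRestrict_omega0 h β F k σ).2]

/-- Field strengths of the restriction (spin average). [cite: Salmhofer1999, §4.2.5 (4.72)] -/
theorem fieldStrength_cutoffRestrict [NeZero M] [NeZero M''] (β : ℝ) (F : HubbardGrassmann L M'') (k : TorusSite 2 L) :
    fieldStrength L M β (cutoffRestrict L h F) k = fieldStrength L M'' β F k := by
  rw [fieldStrength, fieldStrength, fieldStrengthSpin_cutoffRestrict, fieldStrengthSpin_cutoffRestrict]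

/-- The Fermi-curve mismatch of the restriction. [cite: Salmhofer1999, §4.2.5 (4.72)] -/
theorem fermiMismatch_cutoffRestrict [NeZero M] [NeZero M''] (β : ℝ) (e : TorusSite 2 L → ℝ) (Λ : ℝ) (F : HubbardGrassmann L M'') :
    fermiMismatch L M β e Λ (cutoffRestrict L h F) = fermiMismatch L M'' β e Λ F := by
  unfold fermiMismatch
  simp only [(selfEnergy_cutoffRestrict_omega0 h β F _ _).1]

variable (β U μ hs : ℝ) (K : TrigPolyC4v) (Λ : ℝ)

/-- **The two-cutoff comparison of the self-energy is a one-step comparison**: at a window label,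
`Σ″^K_Λ(emb k, σ) - Σ^K_Λ(k, σ)` is the difference of the self-energies of ONE map `V ↦ effAction C^K_{>Λ} V` at the
two initial interactions `π (effAction S V″_K)` and `V_K` (every term of whose difference carries a shell line).
[cite: BenfattoGiulianiMastropietro2006, §2.1 (2.6)] -/
theorem selfEnergy_hubbardEffectiveActionCT_emb_sub
    (hZ : IsUnit (effPartitionFn ℂ (hubbardCovShellCT L h β μ hs K Λ) (hubbardInteractionCT L M'' β U K)))
    (k : FreqMomentum L M) (σ : Fin 2) :
    selfEnergy L M'' β (hubbardEffectiveActionCT L M'' β U μ hs K Λ) (FreqMomentum.emb h k) σ -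
        selfEnergy L M β (hubbardEffectiveActionCT L M β U μ hs K Λ) k σ =
      selfEnergy L M β (effAction ℂ (hubbardCovAboveCT L M β μ hs K Λ)
          (cutoffRestrict L h (effAction ℂ (hubbardCovShellCT L h β μ hs K Λ) (hubbardInteractionCT L M'' β U K)))) k σ -
        selfEnergy L M β (effAction ℂ (hubbardCovAboveCT L M β μ hs K Λ) (hubbardInteractionCT L M β U K)) k σ := by
  rw [← selfEnergy_cutoffRestrict, cutoffRestrict_hubbardEffectiveActionCT h β U μ hs K Λ hZ, hubbardEffectiveActionCT]

end Kernels

/-! ### §7 Below the shell floor the infrared slices are pure window -/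

section Slices

variable {L : ℕ} {M M'' N : ℕ} (h : M ≤ M'') (β μ hs : ℝ) (K : TrigPolyC4v)

/-- The cutoff weight is `1` at frequencies above the scale: `w^K_Λ(k) = 1` if `0 < Λ ≤ |ω(k)|`. [cite: Salmhofer1999, §4.2.5 (4.70)] -/
theorem hubbardCutoffWeightCT_eq_one_of_le {Λ : ℝ} (hΛ : 0 < Λ) {k : FreqMomentum L N} (hk : Λ ≤ |matsubaraFreq β N k.1|) :
    hubbardCutoffWeightCT L N β μ K Λ k = 1 := by
  rw [hubbardCutoffWeightCT, salmhoferCutoff_of_ge]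
  rw [le_div_iff₀ (by positivity), one_mul]
  calc Λ ^ 2 ≤ matsubaraFreq β N k.1 ^ 2 := by
        rw [← sq_abs (matsubaraFreq _ _ _)]; exact pow_le_pow_left₀ hΛ.le hk 2
    _ ≤ matsubaraFreq β N k.1 ^ 2 + nambuXiCT L μ K k.2 ^ 2 := le_add_of_nonneg_right (sq_nonneg _)

/-- **On the shell the weight of every scale below the shell floor is `1`** (`0 < Λ ≤ π(2M+1)/β`).
[cite: Salmhofer1999, §4.2.5 (4.70)] -/
theorem hubbardCutoffWeightCT_eq_one_of_not_mem (hβ : 0 < β) {Λ : ℝ} (hΛ : 0 < Λ) (hΛle : Λ ≤ Real.pi * (2 * M + 1) / β)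
    {k : FreqMomentum L M''} (hk : k ∉ Set.range (FreqMomentum.emb (L := L) h)) :
    hubbardCutoffWeightCT L M'' β μ K Λ k = 1 :=
  hubbardCutoffWeightCT_eq_one_of_le β μ K hΛ
    (hΛle.trans (le_abs_matsubaraFreq_of_not_mem_range hβ h (by rwa [FreqMomentum.mem_range_emb_iff] at hk)))

/-- Shell × shell entries of a slice covariance below the shell floor vanish. [cite: Salmhofer1999, §4.2.5 (4.70)] -/
theorem hubbardCovSliceCT_of_not_mem (hβ : 0 < β) {Λ Λ' : ℝ} (hΛ : 0 < Λ) (hΛle : Λ ≤ Real.pi * (2 * M + 1) / β)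
    (hΛ' : 0 < Λ') (hΛ'le : Λ' ≤ Real.pi * (2 * M + 1) / β) {X Y : HubbardFieldIdx L M''}
    (hX : X ∉ Set.range (HubbardFieldIdx.emb (L := L) h)) (hY : Y ∉ Set.range (HubbardFieldIdx.emb (L := L) h)) :
    hubbardCovSliceCT L M'' β μ hs K Λ Λ' X Y = 0 := by
  rw [HubbardFieldIdx.mem_range_emb_iff] at hX hY
  rw [hubbardCovSliceCT, Matrix.sub_apply, hubbardCovAboveCT, hubbardCovAboveCT, Matrix.of_apply, Matrix.of_apply,
    hubbardCutoffWeightCT_eq_one_of_not_mem h β μ K hβ hΛ hΛle hX, hubbardCutoffWeightCT_eq_one_of_not_mem h β μ K hβ hΛ hΛle hY,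
    hubbardCutoffWeightCT_eq_one_of_not_mem h β μ K hβ hΛ' hΛ'le hX, hubbardCutoffWeightCT_eq_one_of_not_mem h β μ K hβ hΛ' hΛ'le hY,
    sub_self]

variable [NeZero L]

/-- **Below the shell floor the slice covariances at cutoff `M″` are pure window**:
`C″^K_{(Λ,Λ′]} = Eᵀ C^K_{(Λ,Λ′]} E` for `0 < Λ, Λ′ ≤ π(2M+1)/β`. [cite: Salmhofer1999, §4.2.5 (4.70)] -/
theorem hubbardCovSliceCT_eq_windowConj (hβ : 0 < β) {Λ Λ' : ℝ} (hΛ : 0 < Λ) (hΛle : Λ ≤ Real.pi * (2 * M + 1) / β)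
    (hΛ' : 0 < Λ') (hΛ'le : Λ' ≤ Real.pi * (2 * M + 1) / β) :
    hubbardCovSliceCT L M'' β μ hs K Λ Λ' = (windowMatrix L h).transpose * hubbardCovSliceCT L M β μ hs K Λ Λ' * windowMatrix L h := by
  ext X Y
  by_cases hX : X ∈ Set.range (HubbardFieldIdx.emb (L := L) h)
  · obtain ⟨X, rfl⟩ := hX
    by_cases hY : Y ∈ Set.range (HubbardFieldIdx.emb (L := L) h)
    · obtain ⟨Y, rfl⟩ := hY
      rw [windowConj_apply_emb, hubbardCovSliceCT, hubbardCovSliceCT, Matrix.sub_apply, Matrix.sub_apply,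
        hubbardCovAboveCT_emb, hubbardCovAboveCT_emb]
    · have hY' : momentumOf L M'' Y ∉ Set.range (FreqMomentum.emb (L := L) h) := by rwa [← HubbardFieldIdx.mem_range_emb_iff]
      rw [windowConj_apply_of_not_mem_right h _ _ hY, hubbardCovSliceCT, Matrix.sub_apply,
        hubbardCovAboveCT_window_shell h β μ hs K Λ ⟨momentumOf L M X, rfl⟩ hY',
        hubbardCovAboveCT_window_shell h β μ hs K Λ' ⟨momentumOf L M X, rfl⟩ hY', sub_self]
  · by_cases hY : Y ∈ Set.range (HubbardFieldIdx.emb (L := L) h)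
    · obtain ⟨Y, rfl⟩ := hY
      have hX' : momentumOf L M'' X ∉ Set.range (FreqMomentum.emb (L := L) h) := by rwa [← HubbardFieldIdx.mem_range_emb_iff]
      rw [windowConj_apply_of_not_mem_left h _ hX, hubbardCovSliceCT, Matrix.sub_apply,
        hubbardCovAboveCT_shell_window h β μ hs K Λ hX' ⟨momentumOf L M Y, rfl⟩,
        hubbardCovAboveCT_shell_window h β μ hs K Λ' hX' ⟨momentumOf L M Y, rfl⟩, sub_self]
    · rw [windowConj_apply_of_not_mem_left h _ hX, hubbardCovSliceCT_of_not_mem h β μ hs K hβ hΛ hΛle hΛ' hΛ'le hX hY]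

/-- **Every infrared step below the shell floor restricts**: `π (effAction C″^K_{(Λ,Λ′]} F) = effAction C^K_{(Λ,Λ′]} (π F)`
— the cutoff `M` enters a multiscale tower only through its first (ultraviolet) step. [cite: Salmhofer1999, §2.5.1 (2.106)] -/
theorem cutoffRestrict_effAction_hubbardCovSliceCT (hβ : 0 < β) {Λ Λ' : ℝ} (hΛ : 0 < Λ) (hΛle : Λ ≤ Real.pi * (2 * M + 1) / β)
    (hΛ' : 0 < Λ') (hΛ'le : Λ' ≤ Real.pi * (2 * M + 1) / β) (F : HubbardGrassmann L M'') :
    cutoffRestrict L h (effAction ℂ (hubbardCovSliceCT L M'' β μ hs K Λ Λ') F) =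
      effAction ℂ (hubbardCovSliceCT L M β μ hs K Λ Λ') (cutoffRestrict L h F) := by
  rw [hubbardCovSliceCT_eq_windowConj h β μ hs K hβ hΛ hΛle hΛ' hΛ'le, cutoffRestrict_effAction_windowConj]

/-- On shell × shell, below the shell floor, the shell covariance is the FULL covariance at cutoff `M″`
(weight `1`). [cite: Salmhofer1999, §4.2.5 (4.70)] -/
theorem hubbardCovShellCT_of_not_mem_eq (hβ : 0 < β) {Λ : ℝ} (hΛ : 0 < Λ) (hΛle : Λ ≤ Real.pi * (2 * M + 1) / β)
    {X Y : HubbardFieldIdx L M''} (hX : X ∉ Set.range (HubbardFieldIdx.emb (L := L) h)) (hY : Y ∉ Set.range (HubbardFieldIdx.emb (L := L) h)) :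
    hubbardCovShellCT L h β μ hs K Λ X Y = hubbardCovarianceCT L M'' β μ hs K X Y := by
  rw [hubbardCovShellCT_of_not_mem h β μ hs K Λ hX hY, hubbardCovAboveCT, Matrix.of_apply]
  rw [HubbardFieldIdx.mem_range_emb_iff] at hX hY
  rw [hubbardCutoffWeightCT_eq_one_of_not_mem h β μ K hβ hΛ hΛle hX, hubbardCutoffWeightCT_eq_one_of_not_mem h β μ K hβ hΛ hΛle hY]
  norm_num

/-- **Below the shell floor the shell covariance does not depend on the scale.** [cite: Salmhofer1999, §4.2.5 (4.70)] -/
theorem hubbardCovShellCT_eq_of_le (hβ : 0 < β) {Λ Λ' : ℝ} (hΛ : 0 < Λ) (hΛle : Λ ≤ Real.pi * (2 * M + 1) / β)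
    (hΛ' : 0 < Λ') (hΛ'le : Λ' ≤ Real.pi * (2 * M + 1) / β) :
    hubbardCovShellCT L h β μ hs K Λ = hubbardCovShellCT L h β μ hs K Λ' := by
  ext X Y
  by_cases hX : X ∈ Set.range (HubbardFieldIdx.emb (L := L) h)
  · obtain ⟨X, rfl⟩ := hX
    rw [hubbardCovShellCT_emb_left, hubbardCovShellCT_emb_left]
  by_cases hY : Y ∈ Set.range (HubbardFieldIdx.emb (L := L) h)
  · obtain ⟨Y, rfl⟩ := hY
    rw [hubbardCovShellCT_emb_right, hubbardCovShellCT_emb_right]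
  rw [hubbardCovShellCT_of_not_mem_eq h β μ hs K hβ hΛ hΛle hX hY, hubbardCovShellCT_of_not_mem_eq h β μ hs K hβ hΛ' hΛ'le hX hY]

end Slices

end Literature.MathematicalPhysics.QuantumLattice
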